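import Literature.Analysis.FluidPDE.FiniteFourierModeEulerBeltrami

/-!
# Kishimoto–Yoneda, Lemma 4.5 (ii): three collinear frequencies cannot carry transported Beltrami vectors

Support file for `FiniteFourierModeEuler` (N. Kishimoto, T. Yoneda, J. Math. Fluid Mech. 24
(2022) 74 = arXiv:2110.08039), PROVED: the analytic core of Lemma 4.5 (ii) / Prop. 4.4 (ii)
("`|n₁| = |n₂| = |n₃|`, which is, however, impossible because these three points are collinear"):
a Beltrami vector at `n` cannot be non-interacting with non-zero divergence-free vectors at two
further distinct points of a line through `n` (`IsBV.false_of_two_on_ray`), since transport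
(Remark 4.3 (iv), `KY.IsBV.transport`) would make them Beltrami with the same eigenvalue, hence
of the same length (`IsBV.sq_eq`), and `|n + θe| = |n|` has at most one solution `θ ≠ 0`
(`eq_of_dot_self_eq_on_ray`).

## References

* [KishimotoYoneda2022] N. Kishimoto, T. Yoneda, J. Math. Fluid Mech. 24 (2022) 74 =
  arXiv:2110.08039, §4 Lemma 4.5 (ii), Prop. 4.4 (ii), Remark 4.3 (iv).
-/

noncomputable section

open Matrix

namespace Literature.Analysis.FluidPDE

namespace KY

/-! ### Three collinear points cannot lie on one sphere -/

/-- `|n + θe|²`. [folklore] -/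
theorem dot_self_add_smul (n e : Fin 3 → ℝ) (θ : ℝ) :
    (n + θ • e) ⬝ᵥ (n + θ • e) = n ⬝ᵥ n + 2 * θ * (n ⬝ᵥ e) + θ ^ 2 * (e ⬝ᵥ e) := by
  simp only [dotProduct_add, add_dotProduct, dotProduct_smul, smul_dotProduct, smul_eq_mul,
    dotProduct_comm e n]
  ring

/-- Two points `n + θe`, `n + θ'e` (`θ, θ' ≠ 0`) of the line through `n` with the same length
as `n` coincide. [folklore] -/
theorem eq_of_dot_self_eq_on_ray {n e : Fin 3 → ℝ} (he : e ≠ 0) {θ θ' : ℝ} (hθ : θ ≠ 0)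
    (hθ' : θ' ≠ 0) (h1 : (n + θ • e) ⬝ᵥ (n + θ • e) = n ⬝ᵥ n)
    (h2 : (n + θ' • e) ⬝ᵥ (n + θ' • e) = n ⬝ᵥ n) : θ = θ' := by
  rw [dot_self_add_smul] at h1 h2
  have hee : e ⬝ᵥ e ≠ 0 := real_dot_self_ne_zero he
  have e1 : 2 * (n ⬝ᵥ e) + θ * (e ⬝ᵥ e) = 0 := by
    have : θ * (2 * (n ⬝ᵥ e) + θ * (e ⬝ᵥ e)) = 0 := by linear_combination h1
    exact (mul_eq_zero.1 this).resolve_left hθ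
  have e2 : 2 * (n ⬝ᵥ e) + θ' * (e ⬝ᵥ e) = 0 := by
    have : θ' * (2 * (n ⬝ᵥ e) + θ' * (e ⬝ᵥ e)) = 0 := by linear_combination h2
    exact (mul_eq_zero.1 this).resolve_left hθ'
  have : (θ - θ') * (e ⬝ᵥ e) = 0 := by linear_combination e1 - e2
  exact sub_eq_zero.1 ((mul_eq_zero.1 this).resolve_right hee)

/-- [folklore] -/
theorem cross_self_add_smul (n e : Fin 3 → ℝ) (θ : ℝ) : n ⨯₃ (n + θ • e) = θ • (n ⨯₃ e) := by
  rw [map_add, map_smul, cross_self, zero_add]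

/-- **Lemma 4.5 (ii) / Prop. 4.4 (ii), analytic core.** A Beltrami vector at `n` cannot be
non-interacting with non-zero divergence-free vectors sitting at two further distinct points of a
line through `n` which does not pass through the origin: by transport (Remark 4.3 (iv)) both would
be Beltrami with the same eigenvalue, hence of the same length as `n`, and a line meets a sphere in
at most two points. [cite: KishimotoYoneda2022, §4 Lemma 4.5 (ii), Prop. 4.4 (ii)] -/
theorem IsBV.false_of_two_on_ray {μ : ℝ} {n e : Fin 3 → ℝ} {θ₂ θ₃ : ℝ} {u₁ u₂ u₃ : Fin 3 → ℂ}
    (h₁ : IsBV μ n u₁) (hk : n ⨯₃ e ≠ 0) (hθ₂ : θ₂ ≠ 0) (hθ₃ : θ₃ ≠ 0) (h23 : θ₂ ≠ θ₃)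
    (hu₂ : u₂ ≠ 0) (hu₃ : u₃ ≠ 0) (hd₂ : dot (cplx (n + θ₂ • e)) u₂ = 0)
    (hd₃ : dot (cplx (n + θ₃ • e)) u₃ = 0)
    (hNI₂ : NonInteracting n (n + θ₂ • e) u₁ u₂) (hNI₃ : NonInteracting n (n + θ₃ • e) u₁ u₃) :
    False := by
  have hn : n ≠ 0 := left_ne_zero_of_cross_ne_zero hk
  have he : e ≠ 0 := right_ne_zero_of_cross_ne_zero hk
  have hk₂ : n ⨯₃ (n + θ₂ • e) ≠ 0 := by rw [cross_self_add_smul]; exact smul_ne_zero hθ₂ hk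
  have hk₃ : n ⨯₃ (n + θ₃ • e) ≠ 0 := by rw [cross_self_add_smul]; exact smul_ne_zero hθ₃ hk
  have h₂ := h₁.transport hk₂ hu₂ hd₂ hNI₂
  have h₃ := h₁.transport hk₃ hu₃ hd₃ hNI₃
  have s₁ := h₁.sq_eq hn
  have s₂ := h₂.sq_eq (right_ne_zero_of_cross_ne_zero hk₂)
  have s₃ := h₃.sq_eq (right_ne_zero_of_cross_ne_zero hk₃)
  exact h23 (eq_of_dot_self_eq_on_ray he hθ₂ hθ₃ (by rw [← s₂, s₁]) (by rw [← s₃, s₁]))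


end KY

end Literature.Analysis.FluidPDE
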